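import Literature.MathematicalPhysics.QuantumFieldTheory.CubicalStarFour
import Literature.MathematicalPhysics.QuantumFieldTheory.VillainFluxReal
import HarnessLib

/-!
# Local integer primitives of closed cube fields of a box (the reflection principle for
# monopole densities ending on the boundary)

Support file for the Coulomb-gas (monopole) representation of four-dimensional `U(1)` lattice gauge
theory with the Villain action (proof programme of the named fact
`Literature.MathematicalPhysics.QuantumFieldTheory.FrohlichSpencerU1PerimeterLawD4` and of its
corollary `Literature.Barriers.QuantumFields.AbelianDeconfinementD4`). In the last step of the
Fröhlich–Spencer lower bound on the Wilson loop (FS82 §2.10) the phase of a monopole density `ρ` of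
a 1-ensemble is rewritten, by the periodicity of the cosine, as `θ_ρ = 2π(μ_ρ, ε)` with an INTEGER
2-form `μ_ρ`, `dμ_ρ = ρ`, supported near `supp ρ` and bounded by `‖ρ‖₁` (FS82 Lemma 1, (2.56),
(2.84); tree: `CubicalStarFour.exists_d₂_eq_of_cd₃_apply_eq_zero` for densities closed in `ℤ⁴`).
With free boundary conditions the densities of the gas on the box `B_n` are only closed on the
4-cells OF THE BOX — monopole currents may end on `∂B_n` — and the zero extension of such a
density touching the boundary is not closed in `ℤ⁴`. This file supplies the local integer
primitive in that case by the reflection principle: a density is reflected, one direction at a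
time, across the hyperplane half a lattice unit outside each face it touches (with the orientation
sign of the pulled-back 3-cells), which produces a cochain closed in a doubled box and touching
fewer faces; after four steps the zero extension is closed in `ℤ⁴`, Lemma 1 applies, and the
primitive is restricted to the plaquettes of `B_n`.

* `LatticeChain.reflS`, `refl₃` (pull-back of 3-cochains with the orientation sign), `refl₃_refl₃`,
  **`cd₃_refl₃`** (naturality of the coboundary on the 4-cells), `symm₃ = Q + r^*Q`;
* `CubeIn`, `CellIn`, `SuppIn`, `ClosedIn`, `NoTouchLo/Hi`, `Bounds`, `L1Bound` and the one-step
  lemmas `suppIn_symm₃`, `closedIn_symm₃` (old cells / mirror cells / self-mirror gap cells),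
  `bounds_symm₃`, `noTouch_symm₃_self`, `noTouch_symm₃_of_ne`, `symm₃_apply_of_cubeIn`,
  `l1Bound_symm₃`; `cd₃_apply_eq_zero_of_noTouch` (zero extension of a cochain touching no face);
* `VillainAngle.ReflState`, `reflState_zero/succ` (the four-step procedure) and
  **`VillainAngle.exists_local_intPrimitive`**: a closed integer cube field `k` of `B_n` whose
  support never meets two opposite faces is `fluxMap m` for an integer plaquette field `m`
  supported in the `2`-neighbourhood of the bounding box of `supp k`, with `|m| ≤ 16 ‖k‖₁`.

Everything is proved; no named fact is introduced.

## References

* J. Fröhlich, T. Spencer, Comm. Math. Phys. 83 (1982) 411–454, §2.3 Lemma 1 (p. 421), §2.7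
  (2.56), §2.10 (2.84). [FrohlichSpencerCMP1982]
-/

noncomputable section

open Finset Function Literature.Probability.LatticeModels

namespace Literature.MathematicalPhysics.QuantumFieldTheory

/-- Sites of `ℤ^d` (the namespace-local `Site` is the torus one). -/
local notation "ZSite" => Literature.Probability.LatticeModels.Site

namespace LatticeChain

open LatticeForm (e d₂)

/-- Integer 3-cochain data on `ℤ⁴` (components on all direction triples). [folklore] -/
abbrev C3 : Type := ZSite 4 → Fin 4 → Fin 4 → Fin 4 → ℤ

/-! ### Reflections of `ℤ⁴` in a coordinate hyperplane `x_a = t/2` -/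

/-- The reflection `x_a ↦ t - x_a` (other coordinates fixed). [folklore] -/
def reflS (a : Fin 4) (t : ℤ) (x : ZSite 4) : ZSite 4 := Function.update x a (t - x a)

/-- Coordinates of the reflected site. [folklore] -/
theorem reflS_apply (a : Fin 4) (t : ℤ) (x : ZSite 4) (b : Fin 4) :
    reflS a t x b = if b = a then t - x a else x b := by
  simp only [reflS, Function.update_apply]

/-- The reflected coordinate. [folklore] -/
@[simp] theorem reflS_apply_same (a : Fin 4) (t : ℤ) (x : ZSite 4) : reflS a t x a = t - x a := by
  simp [reflS_apply]

/-- The other coordinates are fixed. [folklore] -/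
theorem reflS_apply_ne {a b : Fin 4} (h : b ≠ a) (t : ℤ) (x : ZSite 4) : reflS a t x b = x b := by
  simp [reflS_apply, h]

/-- `reflS a t` is an involution. [folklore] -/
@[simp] theorem reflS_reflS (a : Fin 4) (t : ℤ) (x : ZSite 4) : reflS a t (reflS a t x) = x := by
  ext b
  rcases eq_or_ne b a with rfl | h
  · simp
  · simp [reflS_apply_ne h]

/-- `reflS a t (x + e_a) = reflS a t x - e_a`. [folklore] -/
theorem reflS_add_e_same (a : Fin 4) (t : ℤ) (x : ZSite 4) : reflS a t (x + e a) = reflS a t x - e a := by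
  ext b
  simp only [reflS_apply, Pi.add_apply, Pi.sub_apply, LatticeForm.e, Pi.single_apply]
  split_ifs <;> omega

/-- `reflS a t (x - e_a) = reflS a t x + e_a`. [folklore] -/
theorem reflS_sub_e_same (a : Fin 4) (t : ℤ) (x : ZSite 4) : reflS a t (x - e a) = reflS a t x + e a := by
  ext b
  simp only [reflS_apply, Pi.add_apply, Pi.sub_apply, LatticeForm.e, Pi.single_apply]
  split_ifs <;> omega

/-- `reflS a t (x + e_b) = reflS a t x + e_b` for `b ≠ a`. [folklore] -/
theorem reflS_add_e_ne {a b : Fin 4} (h : b ≠ a) (t : ℤ) (x : ZSite 4) :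
    reflS a t (x + e b) = reflS a t x + e b := by
  ext c
  by_cases hca : c = a
  · subst hca
    simp [LatticeForm.e, h.symm]
  · simp [reflS_apply, hca, LatticeForm.e, Pi.single_apply]

/-! ### Pull-back of 3-cochains along the reflection -/

/-- **Pull-back of a 3-cochain along `reflS a t`**: the reflected 3-cell `(x; i, j, k)` is
`(reflS x - e_a; i, j, k)` with reversed orientation when `a ∈ {i, j, k}`, and `(reflS x; i, j, k)`
with the same orientation otherwise. [folklore] -/
def refl₃ (a : Fin 4) (t : ℤ) (Q : C3) : C3 := fun x i j k =>
  if a = i ∨ a = j ∨ a = k then -Q (reflS a t x - e a) i j k else Q (reflS a t x) i j k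

/-- Components through the mirror direction. [folklore] -/
theorem refl₃_apply_mem {a i j k : Fin 4} (h : a = i ∨ a = j ∨ a = k) (t : ℤ) (Q : C3) (x : ZSite 4) :
    refl₃ a t Q x i j k = -Q (reflS a t x - e a) i j k := by
  simp only [refl₃, if_pos h]

/-- Components perpendicular to the mirror direction. [folklore] -/
theorem refl₃_apply_not {a i j k : Fin 4} (h : ¬(a = i ∨ a = j ∨ a = k)) (t : ℤ) (Q : C3) (x : ZSite 4) :
    refl₃ a t Q x i j k = Q (reflS a t x) i j k := by
  simp only [refl₃, if_neg h]

/-- The pull-back is an involution. [folklore] -/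
theorem refl₃_refl₃ (a : Fin 4) (t : ℤ) (Q : C3) : refl₃ a t (refl₃ a t Q) = Q := by
  funext x i j k
  by_cases h : a = i ∨ a = j ∨ a = k
  · rw [refl₃_apply_mem h, refl₃_apply_mem h, neg_neg, reflS_sub_e_same, reflS_reflS, add_sub_cancel_right]
  · rw [refl₃_apply_not h, refl₃_apply_not h, reflS_reflS]

/-- The pull-back is additive. [folklore] -/
theorem refl₃_add (a : Fin 4) (t : ℤ) (Q Q' : C3) : refl₃ a t (Q + Q') = refl₃ a t Q + refl₃ a t Q' := by
  funext x i j k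
  by_cases h : a = i ∨ a = j ∨ a = k
  · simp only [Pi.add_apply, refl₃_apply_mem h]; abel
  · simp only [Pi.add_apply, refl₃_apply_not h]

/-- `cd₃` is additive. [folklore] -/
theorem cd₃_add' (Q Q' : C3) : cd₃ (Q + Q') = cd₃ Q + cd₃ Q' := by
  funext x i j k l
  simp only [cd₃, Pi.add_apply]
  abel

/-- **Naturality of the coboundary under the reflection** (on the increasing 4-cells):
`(d (r^*Q))(x; 0,1,2,3) = -(dQ)(reflS x - e_a; 0,1,2,3)` — the reflected 4-cell with its reversed
orientation. [folklore] -/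
theorem cd₃_refl₃ (a : Fin 4) (t : ℤ) (Q : C3) (x : ZSite 4) :
    cd₃ (refl₃ a t Q) x 0 1 2 3 = -cd₃ Q (reflS a t x - e a) 0 1 2 3 := by
  set z := reflS a t x - e a with hz
  have hx : reflS a t x = z + e a := by rw [hz, sub_add_cancel]
  have hsame : reflS a t (x + e a) = z := by rw [reflS_add_e_same]
  have hne : ∀ b, b ≠ a → reflS a t (x + e b) - e a = z + e b := fun b hb => by
    rw [reflS_add_e_ne hb, hx]; abel
  have hne' : ∀ b, b ≠ a → reflS a t (x + e b) = z + e a + e b := fun b hb => by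
    rw [reflS_add_e_ne hb, hx]
  clear_value z
  clear hz
  obtain rfl | rfl | rfl | rfl : a = 0 ∨ a = 1 ∨ a = 2 ∨ a = 3 := by fin_cases a <;> simp
  · simp only [cd₃,
      refl₃_apply_not (show ¬((0 : Fin 4) = 1 ∨ (0 : Fin 4) = 2 ∨ (0 : Fin 4) = 3) by decide),
      refl₃_apply_mem (show (0 : Fin 4) = 0 ∨ (0 : Fin 4) = 2 ∨ (0 : Fin 4) = 3 by decide),
      refl₃_apply_mem (show (0 : Fin 4) = 0 ∨ (0 : Fin 4) = 1 ∨ (0 : Fin 4) = 3 by decide),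
      refl₃_apply_mem (show (0 : Fin 4) = 0 ∨ (0 : Fin 4) = 1 ∨ (0 : Fin 4) = 2 by decide),
      hx, hsame, hne 1 (by decide), hne 2 (by decide), hne 3 (by decide), add_sub_cancel_right]
    abel
  · simp only [cd₃,
      refl₃_apply_not (show ¬((1 : Fin 4) = 0 ∨ (1 : Fin 4) = 2 ∨ (1 : Fin 4) = 3) by decide),
      refl₃_apply_mem (show (1 : Fin 4) = 1 ∨ (1 : Fin 4) = 2 ∨ (1 : Fin 4) = 3 by decide),
      refl₃_apply_mem (show (1 : Fin 4) = 0 ∨ (1 : Fin 4) = 1 ∨ (1 : Fin 4) = 3 by decide),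
      refl₃_apply_mem (show (1 : Fin 4) = 0 ∨ (1 : Fin 4) = 1 ∨ (1 : Fin 4) = 2 by decide),
      hx, hsame, hne 2 (by decide), hne 3 (by decide), hne' 0 (by decide), add_sub_cancel_right]
    abel
  · simp only [cd₃,
      refl₃_apply_not (show ¬((2 : Fin 4) = 0 ∨ (2 : Fin 4) = 1 ∨ (2 : Fin 4) = 3) by decide),
      refl₃_apply_mem (show (2 : Fin 4) = 1 ∨ (2 : Fin 4) = 2 ∨ (2 : Fin 4) = 3 by decide),
      refl₃_apply_mem (show (2 : Fin 4) = 0 ∨ (2 : Fin 4) = 2 ∨ (2 : Fin 4) = 3 by decide),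
      refl₃_apply_mem (show (2 : Fin 4) = 0 ∨ (2 : Fin 4) = 1 ∨ (2 : Fin 4) = 2 by decide),
      hx, hsame, hne 3 (by decide), hne' 0 (by decide), hne' 1 (by decide), add_sub_cancel_right]
    abel
  · simp only [cd₃,
      refl₃_apply_not (show ¬((3 : Fin 4) = 0 ∨ (3 : Fin 4) = 1 ∨ (3 : Fin 4) = 2) by decide),
      refl₃_apply_mem (show (3 : Fin 4) = 1 ∨ (3 : Fin 4) = 2 ∨ (3 : Fin 4) = 3 by decide),
      refl₃_apply_mem (show (3 : Fin 4) = 0 ∨ (3 : Fin 4) = 2 ∨ (3 : Fin 4) = 3 by decide),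
      refl₃_apply_mem (show (3 : Fin 4) = 0 ∨ (3 : Fin 4) = 1 ∨ (3 : Fin 4) = 3 by decide),
      hx, hsame, hne' 0 (by decide), hne' 1 (by decide), hne' 2 (by decide), add_sub_cancel_right]
    abel

/-- **The symmetrisation** `Q + r^*Q` of a 3-cochain in direction `a`. [folklore] -/
def symm₃ (a : Fin 4) (t : ℤ) (Q : C3) : C3 := Q + refl₃ a t Q

/-- Components of the symmetrisation. [folklore] -/
theorem symm₃_apply (a : Fin 4) (t : ℤ) (Q : C3) (x : ZSite 4) (i j k : Fin 4) :
    symm₃ a t Q x i j k = Q x i j k + refl₃ a t Q x i j k := rfl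


/-! ### Cubes and 4-cells of a box `[lo, hi] ⊆ ℤ⁴` -/

/-- The 3-cell `(y; i, j, k)` lies in the box `[lo, hi]` (all its corners do). [folklore] -/
def CubeIn (lo hi y : ZSite 4) (i j k : Fin 4) : Prop := lo ≤ y ∧ y + e i + e j + e k ≤ hi

/-- The 4-cell `(x; 0, 1, 2, 3)` lies in the box `[lo, hi]`. [folklore] -/
def CellIn (lo hi x : ZSite 4) : Prop := lo ≤ x ∧ x + 1 ≤ hi

/-- `CellIn` coordinatewise. [folklore] -/
theorem cellIn_iff {lo hi x : ZSite 4} : CellIn lo hi x ↔ ∀ b, lo b ≤ x b ∧ x b + 1 ≤ hi b := by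
  simp only [CellIn, Pi.le_def, Pi.add_apply, Pi.one_apply]
  exact forall_and.symm

/-- The far corner of an increasing cube, coordinatewise. [folklore] -/
theorem corner₃_apply (y : ZSite 4) {i j k : Fin 4} (hij : i < j) (hjk : j < k) (b : Fin 4) :
    (y + e i + e j + e k) b = y b + if b = i ∨ b = j ∨ b = k then 1 else 0 := by
  have hij' := hij.ne
  have hjk' := hjk.ne
  have hik' := (hij.trans hjk).ne
  simp only [Pi.add_apply, LatticeForm.e, Pi.single_apply]
  rcases eq_or_ne b i with rfl | h1
  · simp [hij', hik']
  · rcases eq_or_ne b j with rfl | h2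
    · simp [h1, hjk']
    · rcases eq_or_ne b k with rfl | h3
      · simp [h1, h2]
      · simp [h1, h2, h3]

/-- `CubeIn` coordinatewise, for increasing directions. [folklore] -/
theorem cubeIn_iff {lo hi y : ZSite 4} {i j k : Fin 4} (hij : i < j) (hjk : j < k) :
    CubeIn lo hi y i j k ↔ ∀ b, lo b ≤ y b ∧ y b + (if b = i ∨ b = j ∨ b = k then 1 else 0) ≤ hi b := by
  simp only [CubeIn, Pi.le_def, corner₃_apply y hij hjk]
  exact forall_and.symm

/-! ### Cochains supported and closed in a box; touching its faces -/

/-- `Q` is supported on increasing cubes of the box. [folklore] -/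
def SuppIn (Q : C3) (lo hi : ZSite 4) : Prop :=
  ∀ y i j k, Q y i j k ≠ 0 → (i < j ∧ j < k) ∧ CubeIn lo hi y i j k

/-- `Q` is closed on the 4-cells of the box. [folklore] -/
def ClosedIn (Q : C3) (lo hi : ZSite 4) : Prop := ∀ x, CellIn lo hi x → cd₃ Q x 0 1 2 3 = 0

/-- No cube of the support perpendicular to `a` lies in the low face `x_a = lo_a`. [folklore] -/
def NoTouchLo (Q : C3) (lo : ZSite 4) (a : Fin 4) : Prop :=
  ∀ y i j k, Q y i j k ≠ 0 → ¬(a = i ∨ a = j ∨ a = k) → y a ≠ lo a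

/-- No cube of the support perpendicular to `a` lies in the high face `x_a = hi_a`. [folklore] -/
def NoTouchHi (Q : C3) (hi : ZSite 4) (a : Fin 4) : Prop :=
  ∀ y i j k, Q y i j k ≠ 0 → ¬(a = i ∨ a = j ∨ a = k) → y a ≠ hi a

/-- The base points of the support lie in `[A, B]`. [folklore] -/
def Bounds (Q : C3) (A B : ZSite 4) : Prop := ∀ y i j k, Q y i j k ≠ 0 → A ≤ y ∧ y ≤ B

/-- `‖Q‖₁ ≤ M` (as a bound on all finite partial sums). [folklore] -/
def L1Bound (Q : C3) (M : ℤ) : Prop :=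
  ∀ S : Finset (ZSite 4 × Fin 4 × Fin 4 × Fin 4), ∑ c ∈ S, |Q c.1 c.2.1 c.2.2.1 c.2.2.2| ≤ M

/-- `cd₃ Q (x; 0,1,2,3) = 0` when `Q` vanishes on all cubes based at `x` and at the `x + e_b`.
[folklore] -/
theorem cd₃_apply_eq_zero_of_vanish (Q : C3) (x : ZSite 4)
    (h : ∀ y i j k, (y = x ∨ ∃ b, y = x + e b) → Q y i j k = 0) : cd₃ Q x 0 1 2 3 = 0 := by
  have hx0 : ∀ i j k, Q x i j k = 0 := fun i j k => h x i j k (Or.inl rfl)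
  have hxb : ∀ b i j k, Q (x + e b) i j k = 0 := fun b i j k => h _ i j k (Or.inr ⟨b, rfl⟩)
  simp only [cd₃, hx0, hxb, sub_self, add_zero]

/-! ### One reflection step -/

section Step

variable {Q : C3} {lo hi : ZSite 4} {a : Fin 4} {t : ℤ}

/-- In the gap hyperplane the mirror of `x` is `x + e_a`. [folklore] -/
theorem reflS_eq_add_e_of_gap {x : ZSite 4} (hgap : 2 * x a + 1 = t) : reflS a t x = x + e a := by
  ext b
  rcases eq_or_ne b a with rfl | hb
  · simp [LatticeForm.e]; omega
  · simp [reflS_apply_ne hb, LatticeForm.e, hb]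

/-- The `a`-coordinate of the base of the reflected cube. [folklore] -/
theorem reflBase_apply_same (y : ZSite 4) (i j k : Fin 4) :
    (if a = i ∨ a = j ∨ a = k then reflS a t y - e a else reflS a t y) a =
      t - y a - if a = i ∨ a = j ∨ a = k then 1 else 0 := by
  split_ifs <;> simp [LatticeForm.e]

/-- The other coordinates of the base of the reflected cube. [folklore] -/
theorem reflBase_apply_ne (y : ZSite 4) (i j k : Fin 4) {b : Fin 4} (hb : b ≠ a) :
    (if a = i ∨ a = j ∨ a = k then reflS a t y - e a else reflS a t y) b = y b := by
  split_ifs <;> simp [reflS_apply_ne hb, LatticeForm.e, hb]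

/-- The pull-back in terms of the reflected base point. [folklore] -/
theorem refl₃_apply (a : Fin 4) (t : ℤ) (Q : C3) (y : ZSite 4) (i j k : Fin 4) :
    refl₃ a t Q y i j k = (if a = i ∨ a = j ∨ a = k then -1 else 1) *
      Q (if a = i ∨ a = j ∨ a = k then reflS a t y - e a else reflS a t y) i j k := by
  by_cases h : a = i ∨ a = j ∨ a = k
  · simp [refl₃_apply_mem h, h]
  · simp [refl₃_apply_not h, h]

/-- A non-zero pulled-back component comes from a non-zero component at the reflected cube.
[folklore] -/
theorem ne_zero_of_refl₃_ne_zero {y : ZSite 4} {i j k : Fin 4} (h : refl₃ a t Q y i j k ≠ 0) :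
    Q (if a = i ∨ a = j ∨ a = k then reflS a t y - e a else reflS a t y) i j k ≠ 0 := by
  rw [refl₃_apply] at h
  exact right_ne_zero_of_mul h

/-- A non-zero component of the symmetrisation comes from `Q` or from the reflected cube.
[folklore] -/
theorem ne_zero_or_of_symm₃_ne_zero {y : ZSite 4} {i j k : Fin 4} (h : symm₃ a t Q y i j k ≠ 0) :
    Q y i j k ≠ 0 ∨
      Q (if a = i ∨ a = j ∨ a = k then reflS a t y - e a else reflS a t y) i j k ≠ 0 := by
  by_contra hc
  simp only [ne_eq, not_or, not_not] at hc
  apply h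
  rw [symm₃_apply, hc.1, refl₃_apply, hc.2, mul_zero, add_zero]

/-- **The reflected cochain is supported in the enlarged box.** [folklore] -/
theorem suppIn_symm₃ (hsupp : SuppIn Q lo hi) :
    SuppIn (symm₃ a t Q) (update lo a (min (lo a) (t - hi a))) (update hi a (max (hi a) (t - lo a))) := by
  intro y i j k hne
  rcases ne_zero_or_of_symm₃_ne_zero hne with h | h
  · obtain ⟨⟨hij, hjk⟩, hcube⟩ := hsupp _ _ _ _ h
    refine ⟨⟨hij, hjk⟩, (cubeIn_iff hij hjk).2 fun b => ?_⟩
    have hb := (cubeIn_iff hij hjk).1 hcube b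
    rcases eq_or_ne b a with rfl | hba
    · simp only [update_self]
      exact ⟨(min_le_left _ _).trans hb.1, hb.2.trans (le_max_left _ _)⟩
    · simp only [update_of_ne hba]
      exact hb
  · obtain ⟨⟨hij, hjk⟩, hcube⟩ := hsupp _ _ _ _ h
    refine ⟨⟨hij, hjk⟩, (cubeIn_iff hij hjk).2 fun b => ?_⟩
    have hb := (cubeIn_iff hij hjk).1 hcube b
    rcases eq_or_ne b a with rfl | hba
    · rw [reflBase_apply_same] at hb
      simp only [update_self]
      constructor
      · refine (min_le_right _ _).trans ?_
        split_ifs at hb <;> omega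
      · refine le_trans ?_ (le_max_right _ _)
        split_ifs at hb <;> omega
    · rw [reflBase_apply_ne _ _ _ _ hba] at hb
      simp only [update_of_ne hba]
      exact hb

/-- Bounds for the indicator of the mirror direction. [folklore] -/
theorem ind_bounds (a i j k : Fin 4) :
    (0 : ℤ) ≤ (if a = i ∨ a = j ∨ a = k then (1 : ℤ) else 0) ∧
      (if a = i ∨ a = j ∨ a = k then (1 : ℤ) else 0) ≤ 1 := by
  split_ifs <;> simp

/-- **The base points of the reflected support.** [folklore] -/
theorem bounds_symm₃ {A B : ZSite 4} (hAB : Bounds Q A B) :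
    Bounds (symm₃ a t Q) (update A a (min (A a) (t - B a - 1))) (update B a (max (B a) (t - A a))) := by
  intro y i j k hne
  rw [Pi.le_def, Pi.le_def]
  have hmn1 := min_le_left (A a) (t - B a - 1)
  have hmn2 := min_le_right (A a) (t - B a - 1)
  have hmx1 := le_max_left (B a) (t - A a)
  have hmx2 := le_max_right (B a) (t - A a)
  rcases ne_zero_or_of_symm₃_ne_zero hne with h | h
  · obtain ⟨hA, hB⟩ := hAB _ _ _ _ h
    rw [Pi.le_def] at hA hB
    refine ⟨fun b => ?_, fun b => ?_⟩
    · rcases eq_or_ne b a with rfl | hba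
      · rw [update_self]; exact hmn1.trans (hA b)
      · rw [update_of_ne hba]; exact hA b
    · rcases eq_or_ne b a with rfl | hba
      · rw [update_self]; exact (hB b).trans hmx1
      · rw [update_of_ne hba]; exact hB b
  · obtain ⟨hA, hB⟩ := hAB _ _ _ _ h
    rw [Pi.le_def] at hA hB
    have h1 := hA a
    have h2 := hB a
    rw [reflBase_apply_same] at h1 h2
    have hind := ind_bounds a i j k
    generalize (if a = i ∨ a = j ∨ a = k then (1 : ℤ) else 0) = ind at h1 h2 hind
    refine ⟨fun b => ?_, fun b => ?_⟩
    · rcases eq_or_ne b a with rfl | hba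
      · rw [update_self]; omega
      · have h3 := hA b
        rw [reflBase_apply_ne _ _ _ _ hba] at h3
        rw [update_of_ne hba]; exact h3
    · rcases eq_or_ne b a with rfl | hba
      · rw [update_self]; omega
      · have h3 := hB b
        rw [reflBase_apply_ne _ _ _ _ hba] at h3
        rw [update_of_ne hba]; exact h3

/-- The `a`-extent of a cube meeting the support of `Q`. [folklore] -/
theorem extent_of_ne_zero (hsupp : SuppIn Q lo hi) {y : ZSite 4} {i j k : Fin 4} (h : Q y i j k ≠ 0) :
    lo a ≤ y a ∧ y a + (if a = i ∨ a = j ∨ a = k then 1 else 0) ≤ hi a := by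
  obtain ⟨⟨hij, hjk⟩, hcube⟩ := hsupp _ _ _ _ h
  exact (cubeIn_iff hij hjk).1 hcube a

/-- The reflection does not change `Q` on the cubes of the old box. [folklore] -/
theorem symm₃_apply_of_cubeIn (hsupp : SuppIn Q lo hi) (hside : t = 2 * lo a - 1 ∨ t = 2 * hi a + 1)
    {y : ZSite 4} {i j k : Fin 4} (hij : i < j) (hjk : j < k) (hy : CubeIn lo hi y i j k) :
    symm₃ a t Q y i j k = Q y i j k := by
  rw [symm₃_apply, add_eq_left, refl₃_apply]
  by_contra hne
  have h := right_ne_zero_of_mul hne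
  have h1 := extent_of_ne_zero (a := a) hsupp h
  have h2 := (cubeIn_iff hij hjk).1 hy a
  rw [reflBase_apply_same] at h1
  have hind := ind_bounds a i j k
  generalize (if a = i ∨ a = j ∨ a = k then (1 : ℤ) else 0) = ind at h1 h2 hind
  omega

/-- In the gap hyperplane the cubes through the mirror direction carry nothing. [folklore] -/
theorem symm₃_apply_eq_zero_of_gap (hsupp : SuppIn Q lo hi) (hside : t = 2 * lo a - 1 ∨ t = 2 * hi a + 1)
    {y : ZSite 4} {i j k : Fin 4} (hgap : 2 * y a + 1 = t) (hmem : a = i ∨ a = j ∨ a = k) :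
    symm₃ a t Q y i j k = 0 := by
  by_contra hne
  rcases ne_zero_or_of_symm₃_ne_zero hne with h | h
  · have h1 := extent_of_ne_zero (a := a) hsupp h
    rw [if_pos hmem] at h1
    omega
  · have h1 := extent_of_ne_zero (a := a) hsupp h
    rw [reflBase_apply_same, if_pos hmem] at h1
    omega

/-- In the gap hyperplane the two cubes perpendicular to the mirror direction carry the same value.
[folklore] -/
theorem symm₃_apply_add_e_of_gap {x : ZSite 4} {i j k : Fin 4} (hgap : 2 * x a + 1 = t)
    (hnot : ¬(a = i ∨ a = j ∨ a = k)) : symm₃ a t Q (x + e a) i j k = symm₃ a t Q x i j k := by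
  rw [symm₃_apply, symm₃_apply, refl₃_apply_not hnot, refl₃_apply_not hnot, reflS_add_e_same,
    reflS_eq_add_e_of_gap hgap, add_sub_cancel_right, add_comm]

/-- The `a`-coordinate of a base point `x` or `x + e_b`. [folklore] -/
theorem base_apply_or {x y : ZSite 4} (hy : y = x ∨ ∃ b, y = x + e b) : y a = x a ∨ y a = x a + 1 := by
  rcases hy with rfl | ⟨b, rfl⟩
  · exact Or.inl rfl
  · rcases eq_or_ne b a with rfl | hb
    · right; simp [LatticeForm.e]
    · left; simp [LatticeForm.e, hb.symm]

/-- **Old cells**: the symmetrised cochain is closed on the 4-cells of the old box. [folklore] -/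
theorem cd₃_symm₃_of_old (hsupp : SuppIn Q lo hi) (hcl : ClosedIn Q lo hi)
    (hside : t = 2 * lo a - 1 ∨ t = 2 * hi a + 1) {x : ZSite 4} (hx : CellIn lo hi x) :
    cd₃ (symm₃ a t Q) x 0 1 2 3 = 0 := by
  have hxa := (cellIn_iff.1 hx) a
  -- `Q` vanishes around the mirror cell
  have hvan : cd₃ Q (reflS a t x - e a) 0 1 2 3 = 0 := by
    refine cd₃_apply_eq_zero_of_vanish Q _ fun y i j k hy => ?_
    by_contra h
    have h1 := extent_of_ne_zero (a := a) hsupp h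
    have hya := base_apply_or (a := a) hy
    simp only [Pi.sub_apply, reflS_apply_same, LatticeForm.e, Pi.single_eq_same] at hya
    have hind := ind_bounds a i j k
    generalize (if a = i ∨ a = j ∨ a = k then (1 : ℤ) else 0) = ind at h1 hind
    omega
  rw [symm₃, cd₃_add', Pi.add_apply, Pi.add_apply, Pi.add_apply, Pi.add_apply, Pi.add_apply, cd₃_refl₃,
    hcl x hx, hvan, neg_zero, add_zero]

/-- **Mirror cells**: the symmetrised cochain is closed on the mirror images of the old 4-cells.
[folklore] -/
theorem cd₃_symm₃_of_mirror (hsupp : SuppIn Q lo hi) (hcl : ClosedIn Q lo hi)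
    (hside : t = 2 * lo a - 1 ∨ t = 2 * hi a + 1) {x : ZSite 4} (hx : CellIn lo hi (reflS a t x - e a)) :
    cd₃ (symm₃ a t Q) x 0 1 2 3 = 0 := by
  have hxa := (cellIn_iff.1 hx) a
  simp only [Pi.sub_apply, reflS_apply_same, LatticeForm.e, Pi.single_eq_same] at hxa
  -- `Q` vanishes around the mirror cell `x`
  have hvan : cd₃ Q x 0 1 2 3 = 0 := by
    refine cd₃_apply_eq_zero_of_vanish Q _ fun y i j k hy => ?_
    by_contra h
    have h1 := extent_of_ne_zero (a := a) hsupp h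
    have hya := base_apply_or (a := a) hy
    have hind := ind_bounds a i j k
    generalize (if a = i ∨ a = j ∨ a = k then (1 : ℤ) else 0) = ind at h1 hind
    omega
  rw [symm₃, cd₃_add', Pi.add_apply, Pi.add_apply, Pi.add_apply, Pi.add_apply, Pi.add_apply, cd₃_refl₃,
    hcl _ hx, hvan, neg_zero, add_zero]

/-- **Gap cells**: the symmetrised cochain is closed on the self-mirror 4-cells. [folklore] -/
theorem cd₃_symm₃_of_gap (hsupp : SuppIn Q lo hi) (hside : t = 2 * lo a - 1 ∨ t = 2 * hi a + 1)
    {x : ZSite 4} (hgap : 2 * x a + 1 = t) : cd₃ (symm₃ a t Q) x 0 1 2 3 = 0 := by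
  have hg : ∀ (y : ZSite 4) (i j k : Fin 4), y a = x a → (a = i ∨ a = j ∨ a = k) →
      symm₃ a t Q y i j k = 0 := fun y i j k hy hmem =>
    symm₃_apply_eq_zero_of_gap hsupp hside (by rw [hy]; exact hgap) hmem
  have hp : ∀ i j k, ¬(a = i ∨ a = j ∨ a = k) → symm₃ a t Q (x + e a) i j k = symm₃ a t Q x i j k :=
    fun i j k hnot => symm₃_apply_add_e_of_gap hgap hnot
  have hea : ∀ b, b ≠ a → (x + e b) a = x a := fun b hb => by
    simp [LatticeForm.e, hb.symm]
  set R := symm₃ a t Q with hR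
  clear_value R
  clear hR hgap hside hsupp
  obtain rfl | rfl | rfl | rfl : a = 0 ∨ a = 1 ∨ a = 2 ∨ a = 3 := by fin_cases a <;> simp
  · rw [cd₃, hp 1 2 3 (by decide), hg x 0 2 3 rfl (by decide), hg x 0 1 3 rfl (by decide),
      hg x 0 1 2 rfl (by decide), hg (x + e 1) 0 2 3 (hea 1 (by decide)) (by decide),
      hg (x + e 2) 0 1 3 (hea 2 (by decide)) (by decide), hg (x + e 3) 0 1 2 (hea 3 (by decide)) (by decide)]
    ring
  · rw [cd₃, hp 0 2 3 (by decide), hg x 1 2 3 rfl (by decide), hg x 0 1 3 rfl (by decide),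
      hg x 0 1 2 rfl (by decide), hg (x + e 0) 1 2 3 (hea 0 (by decide)) (by decide),
      hg (x + e 2) 0 1 3 (hea 2 (by decide)) (by decide), hg (x + e 3) 0 1 2 (hea 3 (by decide)) (by decide)]
    ring
  · rw [cd₃, hp 0 1 3 (by decide), hg x 1 2 3 rfl (by decide), hg x 0 2 3 rfl (by decide),
      hg x 0 1 2 rfl (by decide), hg (x + e 0) 1 2 3 (hea 0 (by decide)) (by decide),
      hg (x + e 1) 0 2 3 (hea 1 (by decide)) (by decide), hg (x + e 3) 0 1 2 (hea 3 (by decide)) (by decide)]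
    ring
  · rw [cd₃, hp 0 1 2 (by decide), hg x 1 2 3 rfl (by decide), hg x 0 2 3 rfl (by decide),
      hg x 0 1 3 rfl (by decide), hg (x + e 0) 1 2 3 (hea 0 (by decide)) (by decide),
      hg (x + e 1) 0 2 3 (hea 1 (by decide)) (by decide), hg (x + e 2) 0 1 3 (hea 2 (by decide)) (by decide)]
    ring

/-- **The reflected cochain is closed in the enlarged box** (old cells: closedness of `Q`;
mirror cells: naturality; gap cells: the reflection symmetry). [folklore] -/
theorem closedIn_symm₃ (hsupp : SuppIn Q lo hi) (hcl : ClosedIn Q lo hi)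
    (hside : t = 2 * lo a - 1 ∨ t = 2 * hi a + 1) (hlohi : lo a ≤ hi a) :
    ClosedIn (symm₃ a t Q) (update lo a (min (lo a) (t - hi a))) (update hi a (max (hi a) (t - lo a))) := by
  intro x hx
  rw [cellIn_iff] at hx
  have hxa := hx a
  simp only [update_self] at hxa
  have hmn1 := min_le_left (lo a) (t - hi a)
  have hmn2 := min_le_right (lo a) (t - hi a)
  have hmx1 := le_max_left (hi a) (t - lo a)
  have hmx2 := le_max_right (hi a) (t - lo a)
  have hmnc := min_choice (lo a) (t - hi a)
  have hmxc := max_choice (hi a) (t - lo a)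
  generalize min (lo a) (t - hi a) = mn at hxa hmn1 hmn2 hmnc
  generalize max (hi a) (t - lo a) = mx at hxa hmx1 hmx2 hmxc
  have hxb : ∀ b, b ≠ a → lo b ≤ x b ∧ x b + 1 ≤ hi b := fun b hb => by
    have := hx b; simp only [update_of_ne hb] at this; exact this
  -- trichotomy: old cell, mirror cell or gap cell
  have htri : (lo a ≤ x a ∧ x a + 1 ≤ hi a) ∨ (lo a ≤ t - x a - 1 ∧ t - x a - 1 + 1 ≤ hi a) ∨
      2 * x a + 1 = t := by omega
  rcases htri with hold | hmir | hgap
  · exact cd₃_symm₃_of_old hsupp hcl hside (cellIn_iff.2 fun b => by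
      rcases eq_or_ne b a with rfl | hb
      · exact hold
      · exact hxb b hb)
  · exact cd₃_symm₃_of_mirror hsupp hcl hside (cellIn_iff.2 fun b => by
      rcases eq_or_ne b a with rfl | hb
      · simpa [LatticeForm.e] using hmir
      · simpa [reflS_apply_ne hb, LatticeForm.e, hb] using hxb b hb)
  · exact cd₃_symm₃_of_gap hsupp hside hgap

/-- **After the reflection nothing touches the two faces in the mirror direction.** [folklore] -/
theorem noTouch_symm₃_self (hsupp : SuppIn Q lo hi)
    (hside : (t = 2 * lo a - 1 ∧ NoTouchHi Q hi a) ∨ (t = 2 * hi a + 1 ∧ NoTouchLo Q lo a))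
    (hlohi : lo a ≤ hi a) :
    NoTouchLo (symm₃ a t Q) (update lo a (min (lo a) (t - hi a))) a ∧
      NoTouchHi (symm₃ a t Q) (update hi a (max (hi a) (t - lo a))) a := by
  have hQa : ∀ y i j k, Q y i j k ≠ 0 → ¬(a = i ∨ a = j ∨ a = k) →
      lo a ≤ y a ∧ y a ≤ hi a ∧ (NoTouchHi Q hi a → y a ≠ hi a) ∧ (NoTouchLo Q lo a → y a ≠ lo a) := by
    intro y i j k h hnot
    obtain ⟨⟨hij, hjk⟩, hcube⟩ := hsupp _ _ _ _ h
    have h1 := (cubeIn_iff hij hjk).1 hcube a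
    rw [if_neg hnot] at h1
    exact ⟨h1.1, by omega, fun hH => hH _ _ _ _ h hnot, fun hL => hL _ _ _ _ h hnot⟩
  have hmn1 := min_le_left (lo a) (t - hi a)
  have hmn2 := min_le_right (lo a) (t - hi a)
  have hmx1 := le_max_left (hi a) (t - lo a)
  have hmx2 := le_max_right (hi a) (t - lo a)
  have hmnc := min_choice (lo a) (t - hi a)
  have hmxc := max_choice (hi a) (t - lo a)
  constructor
  · intro y i j k hne hnot
    rw [update_self]
    generalize min (lo a) (t - hi a) = mn at hmn1 hmn2 hmnc
    rcases ne_zero_or_of_symm₃_ne_zero hne with h | h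
    · obtain ⟨h1, h2, h3, h4⟩ := hQa _ _ _ _ h hnot
      rcases hside with ⟨ht, hH⟩ | ⟨ht, hL⟩
      · have := h3 hH; omega
      · have := h4 hL; omega
    · rw [if_neg hnot] at h
      obtain ⟨h1, h2, h3, h4⟩ := hQa _ _ _ _ h hnot
      simp only [reflS_apply_same] at h1 h2 h3 h4
      rcases hside with ⟨ht, hH⟩ | ⟨ht, hL⟩
      · have := h3 hH; omega
      · have := h4 hL; omega
  · intro y i j k hne hnot
    rw [update_self]
    generalize max (hi a) (t - lo a) = mx at hmx1 hmx2 hmxc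
    rcases ne_zero_or_of_symm₃_ne_zero hne with h | h
    · obtain ⟨h1, h2, h3, h4⟩ := hQa _ _ _ _ h hnot
      rcases hside with ⟨ht, hH⟩ | ⟨ht, hL⟩
      · have := h3 hH; omega
      · have := h4 hL; omega
    · rw [if_neg hnot] at h
      obtain ⟨h1, h2, h3, h4⟩ := hQa _ _ _ _ h hnot
      simp only [reflS_apply_same] at h1 h2 h3 h4
      rcases hside with ⟨ht, hH⟩ | ⟨ht, hL⟩
      · have := h3 hH; omega
      · have := h4 hL; omega

/-- **The reflection in direction `a` does not create contacts with the faces in the other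
directions.** [folklore] -/
theorem noTouch_symm₃_of_ne {b : Fin 4} (hba : b ≠ a) :
    (NoTouchLo Q lo b → NoTouchLo (symm₃ a t Q) (update lo a (min (lo a) (t - hi a))) b) ∧
      (NoTouchHi Q hi b → NoTouchHi (symm₃ a t Q) (update hi a (max (hi a) (t - lo a))) b) := by
  constructor
  · intro hL y i j k hne hnot
    simp only [update_of_ne hba]
    rcases ne_zero_or_of_symm₃_ne_zero hne with h | h
    · exact hL _ _ _ _ h hnot
    · have := hL _ _ _ _ h hnot
      rwa [reflBase_apply_ne _ _ _ _ hba] at this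
  · intro hH y i j k hne hnot
    simp only [update_of_ne hba]
    rcases ne_zero_or_of_symm₃_ne_zero hne with h | h
    · exact hH _ _ _ _ h hnot
    · have := hH _ _ _ _ h hnot
      rwa [reflBase_apply_ne _ _ _ _ hba] at this

/-- The reflected cube as a function of the cube label. [folklore] -/
def reflCube (a : Fin 4) (t : ℤ) (c : ZSite 4 × Fin 4 × Fin 4 × Fin 4) : ZSite 4 × Fin 4 × Fin 4 × Fin 4 :=
  (if a = c.2.1 ∨ a = c.2.2.1 ∨ a = c.2.2.2 then reflS a t c.1 - e a else reflS a t c.1, c.2)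

/-- `reflCube a t` is injective. [folklore] -/
theorem reflCube_injective (a : Fin 4) (t : ℤ) : Function.Injective (reflCube a t) := by
  rintro ⟨y, i, j, k⟩ ⟨y', i', j', k'⟩ h
  simp only [reflCube, Prod.mk.injEq] at h
  obtain ⟨hy, hijk⟩ := h
  obtain ⟨rfl, rfl, rfl⟩ := hijk
  simp only [Prod.mk.injEq, and_true]
  have key : reflS a t y = reflS a t y' := by
    split_ifs at hy with hm
    · exact sub_left_injective hy
    · exact hy
  simpa using congrArg (reflS a t) key

/-- **The `ℓ¹` norm at most doubles.** [folklore] -/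
theorem l1Bound_symm₃ {M : ℤ} (hM : L1Bound Q M) : L1Bound (symm₃ a t Q) (2 * M) := by
  classical
  intro S
  calc ∑ c ∈ S, |symm₃ a t Q c.1 c.2.1 c.2.2.1 c.2.2.2|
      ≤ ∑ c ∈ S, (|Q c.1 c.2.1 c.2.2.1 c.2.2.2| +
          |Q (reflCube a t c).1 (reflCube a t c).2.1 (reflCube a t c).2.2.1 (reflCube a t c).2.2.2|) := by
        refine Finset.sum_le_sum fun c _ => ?_
        rw [symm₃_apply, refl₃_apply]
        refine (abs_add_le _ _).trans (add_le_add le_rfl (le_of_eq ?_))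
        rw [abs_mul]
        have : |(if a = c.2.1 ∨ a = c.2.2.1 ∨ a = c.2.2.2 then (-1 : ℤ) else 1)| = 1 := by
          split_ifs <;> simp
        rw [this, one_mul]
        rfl
    _ = ∑ c ∈ S, |Q c.1 c.2.1 c.2.2.1 c.2.2.2| +
          ∑ c ∈ S.image (reflCube a t), |Q c.1 c.2.1 c.2.2.1 c.2.2.2| := by
        rw [Finset.sum_add_distrib, Finset.sum_image fun c _ c' _ h => reflCube_injective a t h]
    _ ≤ M + M := add_le_add (hM S) (hM _)
    _ = 2 * M := by ring

end Step

/-! ### A cochain closed in a box and touching none of its faces is closed in `ℤ⁴` -/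

/-- In `Fin 4`, a direction other than the complement of an increasing triple belongs to it.
[folklore] -/
theorem mem_triple_of_ne : ∀ i j k c b : Fin 4, i < j → j < k → ¬(c = i ∨ c = j ∨ c = k) → b ≠ c →
    (b = i ∨ b = j ∨ b = k) := by
  decide

/-- **Zero extension**: a cochain supported and closed in a box none of whose support cubes lies
in a face of the box is closed on every 4-cell of `ℤ⁴`. [folklore] -/
theorem cd₃_apply_eq_zero_of_noTouch {Q : C3} {lo hi : ZSite 4} (hsupp : SuppIn Q lo hi)
    (hcl : ClosedIn Q lo hi) (hno : ∀ a, NoTouchLo Q lo a ∧ NoTouchHi Q hi a) (x : ZSite 4) :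
    cd₃ Q x 0 1 2 3 = 0 := by
  by_cases hx : CellIn lo hi x
  · exact hcl x hx
  rw [cellIn_iff, not_forall] at hx
  obtain ⟨b, hb⟩ := hx
  have claim : ∀ (c : Fin 4) (y : ZSite 4) (i j k : Fin 4), ¬(c = i ∨ c = j ∨ c = k) →
      (y = x ∨ y = x + e c) → Q y i j k = 0 := by
    intro c y i j k hc hy
    by_contra hQ
    obtain ⟨⟨hij, hjk⟩, hcube⟩ := hsupp _ _ _ _ hQ
    have h1 := (cubeIn_iff hij hjk).1 hcube b
    rcases eq_or_ne b c with rfl | hbc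
    · rw [if_neg hc] at h1
      have hL := (hno b).1 _ _ _ _ hQ hc
      have hH := (hno b).2 _ _ _ _ hQ hc
      have hyb : y b = x b ∨ y b = x b + 1 := by
        rcases hy with rfl | rfl
        · left; rfl
        · right; simp [LatticeForm.e]
      omega
    · rw [if_pos (mem_triple_of_ne i j k c b hij hjk hc hbc)] at h1
      have hyb : y b = x b := by
        rcases hy with rfl | rfl
        · rfl
        · simp [LatticeForm.e, hbc]
      omega
  simp only [cd₃, claim 0 x 1 2 3 (by decide) (Or.inl rfl), claim 0 (x + e 0) 1 2 3 (by decide) (Or.inr rfl),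
    claim 1 x 0 2 3 (by decide) (Or.inl rfl), claim 1 (x + e 1) 0 2 3 (by decide) (Or.inr rfl),
    claim 2 x 0 1 3 (by decide) (Or.inl rfl), claim 2 (x + e 2) 0 1 3 (by decide) (Or.inr rfl),
    claim 3 x 0 1 2 (by decide) (Or.inl rfl), claim 3 (x + e 3) 0 1 2 (by decide) (Or.inr rfl),
    sub_self, add_zero]

end LatticeChain

/-! ### The local integer primitive of a closed cube field of the box -/

namespace VillainAngle

open AxialGauge LatticeForm LatticeChain VillainFibre

variable {n : ℕ}

/-- The increasing triples of `Fin 4` are the complements `ĉ_l`. [folklore] -/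
theorem exists_compl₃_eq : ∀ i j k : Fin 4, i < j → j < k → ∃ l : Fin 4, compl₃ l = (i, j, k) := by
  decide

/-- `compl₃` is injective. [folklore] -/
theorem compl₃_injective : Function.Injective compl₃ := by
  intro a b
  revert a b
  decide

/-- The far corner of the 4-cell. [folklore] -/
theorem add_e_four (x : ZSite 4) : x + e 0 + e 1 + e 2 + e 3 = x + 1 := by
  ext b
  simp only [Pi.add_apply, LatticeForm.e, Pi.single_apply, Pi.one_apply]
  fin_cases b <;> simp

/-- The zero extension of a cube field is supported on the increasing cubes of the box. [folklore] -/
theorem suppIn_extCubeA (k : CIdx 4 n → ℤ) : SuppIn (extCubeA k) 0 (top 4 n) := by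
  intro y i j l h
  have hmem : (y, i, j, l) ∈ cubesIn (halfOpenBox 4 n) := by
    by_contra hc; exact h (by simp [extCubeA, hc])
  obtain ⟨hy, hij, hjl, -, -, -, -, -, -, hyijl⟩ := mem_cubesIn.1 hmem
  exact ⟨⟨hij, hjl⟩, (mem_halfOpenBox_iff_mem_Icc.1 hy).1, (mem_halfOpenBox_iff_mem_Icc.1 hyijl).2⟩

/-- The zero extension of a closed cube field is closed on the 4-cells of the box. [folklore] -/
theorem closedIn_extCubeA (k : CIdx 4 n → ℤ) (hk : IsClosedFlux k) : ClosedIn (extCubeA k) 0 (top 4 n) := by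
  intro x hx
  obtain ⟨h0, h1⟩ := hx
  refine hk x 0 1 2 3 (by decide) (by decide) (by decide) (mem_halfOpenBox_iff_mem_Icc.2 ⟨h0, ?_⟩)
    (mem_halfOpenBox_iff_mem_Icc.2 ⟨?_, ?_⟩)
  · exact le_trans (by intro b; simp) h1
  · rw [add_e_four]; exact le_trans h0 (by intro b; simp)
  · rw [add_e_four]; exact h1

/-- A non-zero component of the zero extension is a value of `k` on a cube of the box. [folklore] -/
theorem exists_of_extCubeA_ne_zero' (k : CIdx 4 n → ℤ) {y : ZSite 4} {i j l : Fin 4}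
    (h : extCubeA k y i j l ≠ 0) :
    ∃ hc : (y, i, j, l) ∈ cubesIn (halfOpenBox 4 n), k ⟨(y, i, j, l), hc⟩ ≠ 0 := by
  have hmem : (y, i, j, l) ∈ cubesIn (halfOpenBox 4 n) := by
    by_contra hc; exact h (by simp [extCubeA, hc])
  exact ⟨hmem, by rwa [extCubeA_apply k hmem] at h⟩

/-- **`ℓ¹` bound of the zero extension.** [folklore] -/
theorem l1Bound_extCubeA (k : CIdx 4 n → ℤ) : L1Bound (extCubeA k) (∑ c, |k c|) := by
  classical
  intro S
  set C := cubesIn (halfOpenBox 4 n) with hC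
  calc ∑ c ∈ S, |extCubeA k c.1 c.2.1 c.2.2.1 c.2.2.2|
      = ∑ c ∈ S.filter (· ∈ C), |extCubeA k c.1 c.2.1 c.2.2.1 c.2.2.2| := by
        rw [Finset.sum_filter_of_ne]
        intro c _ hc
        by_contra hmem
        exact hc (by simp [extCubeA, hC ▸ hmem])
    _ ≤ ∑ c ∈ C, |extCubeA k c.1 c.2.1 c.2.2.1 c.2.2.2| :=
        Finset.sum_le_sum_of_subset_of_nonneg (fun c hc => (Finset.mem_filter.1 hc).2)
          fun _ _ _ => abs_nonneg _
    _ = ∑ c, |k c| := by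
        rw [← Finset.sum_coe_sort C]
        refine Finset.sum_congr rfl fun c _ => ?_
        rw [extCubeA_apply k c.2]

/-- Touching the low face forces `A₀ a ≤ 0` for any lower bound `A₀` of the support. [folklore] -/
theorem le_zero_of_touchLo (k : CIdx 4 n → ℤ) {A₀ : ZSite 4} (hA : ∀ c, k c ≠ 0 → A₀ ≤ c.1.1)
    {a : Fin 4} (h : ¬NoTouchLo (extCubeA k) 0 a) : A₀ a ≤ 0 := by
  simp only [NoTouchLo, not_forall, not_not, exists_prop] at h
  obtain ⟨y, i, j, l, hne, -, hy⟩ := h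
  obtain ⟨hc, hk⟩ := exists_of_extCubeA_ne_zero' k hne
  have := hA _ hk a
  simp only [Pi.zero_apply] at hy
  simpa [hy] using this

/-- Touching the high face forces `n - 1 ≤ B₀ a` for any upper bound `B₀` of the support. [folklore] -/
theorem le_of_touchHi (k : CIdx 4 n → ℤ) {B₀ : ZSite 4} (hB : ∀ c, k c ≠ 0 → c.1.1 ≤ B₀)
    {a : Fin 4} (h : ¬NoTouchHi (extCubeA k) (top 4 n) a) : (n : ℤ) - 1 ≤ B₀ a := by
  simp only [NoTouchHi, not_forall, not_not, exists_prop] at h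
  obtain ⟨y, i, j, l, hne, -, hy⟩ := h
  obtain ⟨hc, hk⟩ := exists_of_extCubeA_ne_zero' k hne
  have := hB _ hk a
  simp only [top] at hy
  simpa [hy] using this

/-- `CubeIn` is monotone in the box. [folklore] -/
theorem cubeIn_mono {lo hi lo' hi' y : ZSite 4} {i j k : Fin 4} (hlo : lo' ≤ lo) (hhi : hi ≤ hi')
    (h : CubeIn lo hi y i j k) : CubeIn lo' hi' y i j k :=
  ⟨hlo.trans h.1, h.2.trans hhi⟩

/-- The state of the reflection procedure after `s` directions have been processed. [folklore] -/
structure ReflState (Q₀ : C3) (A₁ B₁ : ZSite 4) (M : ℤ) (n s : ℕ) (Q : C3) (lo hi A B : ZSite 4) : Prop where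
  /-- support in the current box -/
  supp : SuppIn Q lo hi
  /-- closed in the current box -/
  closed : ClosedIn Q lo hi
  /-- base points of the support -/
  bounds : Bounds Q A B
  /-- the `ℓ¹` norm -/
  l1 : L1Bound Q (2 ^ s * M)
  /-- the current box contains the original one -/
  box : ∀ b : Fin 4, lo b ≤ 0 ∧ (n : ℤ) - 1 ≤ hi b
  /-- agreement with `Q₀` on the original cubes -/
  agree : ∀ y i j k, i < j → j < k → CubeIn 0 (top 4 n) y i j k → Q y i j k = Q₀ y i j k
  /-- processed directions: no contact -/
  done : ∀ a : Fin 4, a.val < s → NoTouchLo Q lo a ∧ NoTouchHi Q hi a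
  /-- unprocessed directions: untouched data -/
  todo : ∀ a : Fin 4, s ≤ a.val → lo a = 0 ∧ hi a = (n : ℤ) - 1 ∧ A a = A₁ a ∧ B a = B₁ a ∧
    (NoTouchLo Q₀ 0 a → NoTouchLo Q lo a) ∧ (NoTouchHi Q₀ (top 4 n) a → NoTouchHi Q hi a)
  /-- locality, low side -/
  local_lo : ∀ a : Fin 4, A₁ a ≤ A a ∨ ¬NoTouchLo Q₀ 0 a
  /-- locality, high side -/
  local_hi : ∀ a : Fin 4, B a ≤ B₁ a ∨ ¬NoTouchHi Q₀ (top 4 n) a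

section Procedure

variable {Q₀ : C3} {A₁ B₁ : ZSite 4} {M : ℤ} {s : ℕ} {Q : C3} {lo hi A B : ZSite 4}

/-- **A reflection step of the procedure** (in direction `a = s`, mirror parameter `t`). [folklore] -/
theorem reflState_reflect (h : ReflState Q₀ A₁ B₁ M n s Q lo hi A B) {a : Fin 4} (has : a.val = s) (t : ℤ)
    (hside' : (t = 2 * lo a - 1 ∧ NoTouchHi Q hi a) ∨ (t = 2 * hi a + 1 ∧ NoTouchLo Q lo a))
    (hlohi : lo a ≤ hi a)
    (hlocA : A₁ a ≤ min (A a) (t - B a - 1) ∨ ¬NoTouchLo Q₀ 0 a)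
    (hlocB : max (B a) (t - A a) ≤ B₁ a ∨ ¬NoTouchHi Q₀ (top 4 n) a) :
    ∃ (Q' : C3) (lo' hi' A' B' : ZSite 4), ReflState Q₀ A₁ B₁ M n (s + 1) Q' lo' hi' A' B' := by
  have hside : t = 2 * lo a - 1 ∨ t = 2 * hi a + 1 := by
    rcases hside' with ⟨h1, -⟩ | ⟨h1, -⟩
    · exact Or.inl h1
    · exact Or.inr h1
  have hpow : (2 : ℤ) ^ (s + 1) * M = 2 * (2 ^ s * M) := by ring
  refine ⟨symm₃ a t Q, update lo a (min (lo a) (t - hi a)), update hi a (max (hi a) (t - lo a)),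
    update A a (min (A a) (t - B a - 1)), update B a (max (B a) (t - A a)),
    ⟨suppIn_symm₃ h.supp, closedIn_symm₃ h.supp h.closed hside hlohi, bounds_symm₃ h.bounds,
      hpow ▸ l1Bound_symm₃ h.l1, ?_, ?_, ?_, ?_, ?_, ?_⟩⟩
  · intro b
    rcases eq_or_ne b a with hba | hba
    · rw [hba]
      simp only [update_self]
      exact ⟨(min_le_left _ _).trans (h.box a).1, (h.box a).2.trans (le_max_left _ _)⟩
    · simp only [update_of_ne hba]
      exact h.box b
  · intro y i j k hij hjk hy
    rw [← h.agree y i j k hij hjk hy]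
    refine symm₃_apply_of_cubeIn h.supp hside hij hjk (cubeIn_mono ?_ ?_ hy)
    · intro b; exact (h.box b).1
    · intro b; simpa [top] using (h.box b).2
  · intro b hb
    rcases Nat.lt_succ_iff_lt_or_eq.1 hb with hb | hb
    · have hba : b ≠ a := fun hh => by rw [hh, has] at hb; exact lt_irrefl _ hb
      exact ⟨(noTouch_symm₃_of_ne hba).1 (h.done b hb).1, (noTouch_symm₃_of_ne hba).2 (h.done b hb).2⟩
    · have hba : b = a := Fin.ext (hb.trans has.symm)
      rw [hba]
      exact noTouch_symm₃_self h.supp hside' hlohi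
  · intro b hb
    have hba : b ≠ a := fun hh => by rw [hh, has] at hb; exact Nat.not_succ_le_self _ hb
    obtain ⟨h1, h2, h3, h4, h5, h6⟩ := h.todo b (Nat.le_of_succ_le hb)
    simp only [update_of_ne hba]
    exact ⟨h1, h2, h3, h4, fun hL => (noTouch_symm₃_of_ne hba).1 (h5 hL),
      fun hH => (noTouch_symm₃_of_ne hba).2 (h6 hH)⟩
  · intro b
    rcases eq_or_ne b a with hba | hba
    · rw [hba]; simp only [update_self]; exact hlocA
    · simp only [update_of_ne hba]; exact h.local_lo b
  · intro b
    rcases eq_or_ne b a with hba | hba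
    · rw [hba]; simp only [update_self]; exact hlocB
    · simp only [update_of_ne hba]; exact h.local_hi b

/-- **One step of the reflection procedure**: reflect across the touched face in direction `s`,
if any. [folklore] -/
theorem reflState_succ (hM : 0 ≤ M) (hn : 1 ≤ n)
    (h01 : ∀ a, 0 ≤ A₁ a ∧ A₁ a ≤ B₁ a ∧ B₁ a ≤ (n : ℤ) - 1)
    (hnotboth : ∀ a, NoTouchLo Q₀ 0 a ∨ NoTouchHi Q₀ (top 4 n) a)
    (hs : s < 4) (h : ReflState Q₀ A₁ B₁ M n s Q lo hi A B) :
    ∃ (Q' : C3) (lo' hi' A' B' : ZSite 4), ReflState Q₀ A₁ B₁ M n (s + 1) Q' lo' hi' A' B' := by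
  set a : Fin 4 := ⟨s, hs⟩ with ha
  have has : a.val = s := rfl
  obtain ⟨hlo, hhi, hAa, hBa, htL, htH⟩ := h.todo a le_rfl
  obtain ⟨hA0, hAB1, hBn⟩ := h01 a
  have hlohi : lo a ≤ hi a := by rw [hlo, hhi]; omega
  clear_value a
  by_cases hL : NoTouchLo Q₀ 0 a
  · by_cases hH : NoTouchHi Q₀ (top 4 n) a
    · -- no contact in direction `a`: nothing to do
      have hpow : (2 : ℤ) ^ s * M ≤ 2 ^ (s + 1) * M := by
        rw [pow_succ]
        have : 0 ≤ (2 : ℤ) ^ s * M := by positivity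
        nlinarith
      refine ⟨Q, lo, hi, A, B, ⟨h.supp, h.closed, h.bounds, fun S => (h.l1 S).trans hpow, h.box, h.agree,
        ?_, fun b hb => h.todo b (Nat.le_of_succ_le hb), h.local_lo, h.local_hi⟩⟩
      intro b hb
      rcases Nat.lt_succ_iff_lt_or_eq.1 hb with hb | hb
      · exact h.done b hb
      · have hba : b = a := Fin.ext (hb.trans has.symm)
        rw [hba]
        exact ⟨htL hL, htH hH⟩
    · -- contact with the high face: reflect across it
      refine reflState_reflect h has (2 * hi a + 1) (Or.inr ⟨rfl, htL hL⟩) hlohi (Or.inl ?_) (Or.inr hH)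
      rw [hhi, hAa, hBa]
      refine le_min le_rfl ?_
      omega
  · -- contact with the low face: reflect across it
    have hH : NoTouchHi Q₀ (top 4 n) a := (hnotboth a).resolve_left hL
    refine reflState_reflect h has (2 * lo a - 1) (Or.inl ⟨rfl, htH hH⟩) hlohi (Or.inr hL) (Or.inl ?_)
    rw [hlo, hAa, hBa]
    refine max_le le_rfl ?_
    omega

/-- **The initial state.** [folklore] -/
theorem reflState_zero (k : CIdx 4 n → ℤ) (hk : IsClosedFlux k) {A₀ B₀ : ZSite 4}
    (hAB : ∀ c, k c ≠ 0 → A₀ ≤ c.1.1 ∧ c.1.1 ≤ B₀) :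
    ReflState (extCubeA k) (fun b => max (A₀ b) 0) (fun b => min (B₀ b) ((n : ℤ) - 1)) (∑ c, |k c|) n 0
      (extCubeA k) 0 (top 4 n) (fun b => max (A₀ b) 0) (fun b => min (B₀ b) ((n : ℤ) - 1)) := by
  refine ⟨suppIn_extCubeA k, closedIn_extCubeA k hk, ?_, by simpa using l1Bound_extCubeA k,
    fun b => ⟨le_rfl, by simp [top]⟩, fun _ _ _ _ _ _ _ => rfl, fun b hb => absurd hb (Nat.not_lt_zero _),
    fun b _ => ⟨rfl, rfl, rfl, rfl, id, id⟩, fun b => Or.inl le_rfl, fun b => Or.inl le_rfl⟩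
  intro y i j l h
  obtain ⟨hc, hkc⟩ := exists_of_extCubeA_ne_zero' k h
  obtain ⟨hA, hB⟩ := hAB _ hkc
  obtain ⟨hy, -⟩ := mem_cubesIn.1 hc
  obtain ⟨hy0, hyt⟩ := mem_halfOpenBox_iff_mem_Icc.1 hy
  refine ⟨fun b => max_le (hA b) (hy0 b), fun b => le_min (hB b) ?_⟩
  simpa [top] using hyt b

end Procedure

/-- **Local integer primitives of closed cube fields of the box (the reflection principle).**
Let `k` be an integer 3-cochain on the cubes of `B_n = [0, n-1]⁴` which is closed on the 4-cells of
`B_n` (a monopole current density with free boundary conditions: it may end on `∂B_n`), whose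
support has base points in `[A₀, B₀]` with `B₀ a - A₀ a ≤ n - 2` in every direction (so that it
never meets two opposite faces). Then `k = dm` on the cubes of `B_n` for an INTEGER plaquette field
`m` of `B_n` supported in `[A₀ - 2, B₀ + 1]` with `|m| ≤ 16 ‖k‖₁`. (Reflect `k` across the faces it
touches — one direction at a time, across the hyperplane half a lattice unit outside the face, with
the orientation sign — to a cochain closed in `ℤ⁴`, apply FS82 Lemma 1 in degree three
(`CubicalStarFour`), and restrict the primitive to the box; this supplies the local 2-forms `μ_ρ`
with `dμ_ρ = ρ`, `max |μ_ρ| ≤ ‖ρ‖₁` of FS82 (2.56), (2.84) also for the densities at the boundary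
of the region.) [cite: FrohlichSpencerCMP1982, §2.3 Lemma 1 p. 421, §2.7 (2.56), §2.10 (2.84)] -/
theorem exists_local_intPrimitive (hn : 1 ≤ n) (k : CIdx 4 n → ℤ) (hk : IsClosedFlux k)
    (A₀ B₀ : ZSite 4) (hAB : ∀ c, k c ≠ 0 → A₀ ≤ c.1.1 ∧ c.1.1 ≤ B₀)
    (hsmall : ∀ a, B₀ a - A₀ a + 1 < n) :
    ∃ m : PIdx 4 n → ℤ, fluxMap m = k ∧
      (∀ p, m p ≠ 0 → A₀ - 2 ≤ p.1.1 ∧ p.1.1 ≤ B₀ + 1) ∧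
      ∀ p, |m p| ≤ 16 * ∑ c, |k c| := by
  classical
  by_cases hk0 : k = 0
  · refine ⟨0, by rw [hk0, map_zero], fun p hp => absurd rfl hp, fun p => ?_⟩
    simp only [Pi.zero_apply, abs_zero]
    positivity
  obtain ⟨c₀, hc₀⟩ : ∃ c, k c ≠ 0 := by
    by_contra hc
    push Not at hc
    exact hk0 (funext hc)
  set Q₀ := extCubeA k with hQ₀
  set A₁ : ZSite 4 := fun b => max (A₀ b) 0 with hA₁
  set B₁ : ZSite 4 := fun b => min (B₀ b) ((n : ℤ) - 1) with hB₁
  set M : ℤ := ∑ c, |k c| with hMdef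
  have hM : 0 ≤ M := Finset.sum_nonneg fun _ _ => abs_nonneg _
  have h01 : ∀ a, 0 ≤ A₁ a ∧ A₁ a ≤ B₁ a ∧ B₁ a ≤ (n : ℤ) - 1 := by
    intro a
    obtain ⟨hA, hB⟩ := hAB _ hc₀
    obtain ⟨hy, -⟩ := mem_cubesIn.1 c₀.2
    obtain ⟨hy0, hyt⟩ := mem_halfOpenBox_iff_mem_Icc.1 hy
    have h1 := hA a; have h2 := hB a; have h3 := hy0 a; have h4 := hyt a
    simp only [Pi.zero_apply, top] at h3 h4
    simp only [hA₁, hB₁]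
    refine ⟨le_max_right _ _, ?_, min_le_right _ _⟩
    exact max_le (le_min (h1.trans h2) (h1.trans h4)) (le_min (h3.trans h2) (h3.trans h4))
  have hnotboth : ∀ a, NoTouchLo Q₀ 0 a ∨ NoTouchHi Q₀ (top 4 n) a := by
    intro a
    by_contra hc
    rw [not_or] at hc
    have h1 := le_zero_of_touchLo k (fun c hc => (hAB c hc).1) hc.1
    have h2 := le_of_touchHi k (fun c hc => (hAB c hc).2) hc.2
    have := hsmall a
    omega
  -- four steps
  have st0 := reflState_zero k hk hAB
  obtain ⟨Q₁, lo₁, hi₁, A1, B1, st1⟩ := reflState_succ hM hn h01 hnotboth (by norm_num) st0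
  obtain ⟨Q₂, lo₂, hi₂, A2, B2, st2⟩ := reflState_succ hM hn h01 hnotboth (by norm_num) st1
  obtain ⟨Q₃, lo₃, hi₃, A3, B3, st3⟩ := reflState_succ hM hn h01 hnotboth (by norm_num) st2
  obtain ⟨Q₄, lo₄, hi₄, A4, B4, st4⟩ := reflState_succ hM hn h01 hnotboth (by norm_num) st3
  -- the reflected cochain is closed in `ℤ⁴`
  have hno : ∀ a : Fin 4, NoTouchLo Q₄ lo₄ a ∧ NoTouchHi Q₄ hi₄ a := fun a => st4.done a a.isLt
  have hcl : ∀ x, cd₃ Q₄ x 0 1 2 3 = 0 := cd₃_apply_eq_zero_of_noTouch st4.supp st4.closed hno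
  -- FS82 Lemma 1 in degree three
  set TQ : Finset (ZSite 4 × Fin 4) := Finset.Icc A4 B4 ×ˢ Finset.univ with hTQ
  obtain ⟨ω, -, hd, hsuppω, hle⟩ := exists_d₂_eq_of_cd₃_apply_eq_zero A4 B4 Q₄ hcl
    (fun x l h => st4.bounds _ _ _ _ h) TQ
    (fun x l h => Finset.mem_product.2 ⟨Finset.mem_Icc.2 (st4.bounds _ _ _ _ h), Finset.mem_univ _⟩)
  -- the `ℓ¹` bound of the star-shaped sum
  have hsum : ∑ p ∈ TQ, |Q₄ p.1 (compl₃ p.2).1 (compl₃ p.2).2.1 (compl₃ p.2).2.2| ≤ 16 * M := by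
    have hinj : Set.InjOn (fun p : ZSite 4 × Fin 4 => (p.1, compl₃ p.2)) TQ := by
      rintro ⟨x, l⟩ - ⟨x', l'⟩ - hxl
      simp only [Prod.mk.injEq] at hxl
      exact Prod.ext hxl.1 (compl₃_injective hxl.2)
    have h16 : (2 : ℤ) ^ 4 * M = 16 * M := by norm_num
    calc ∑ p ∈ TQ, |Q₄ p.1 (compl₃ p.2).1 (compl₃ p.2).2.1 (compl₃ p.2).2.2|
        = ∑ c ∈ TQ.image (fun p : ZSite 4 × Fin 4 => (p.1, compl₃ p.2)),
            |Q₄ c.1 c.2.1 c.2.2.1 c.2.2.2| := by rw [Finset.sum_image hinj]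
      _ ≤ 16 * M := h16 ▸ st4.l1 _
  refine ⟨fun p => ω p.1.1 p.1.2.1 p.1.2.2, ?_, ?_, ?_⟩
  · -- `dm = k` on the cubes of the box
    funext c
    obtain ⟨⟨x, i, j, l⟩, hc⟩ := c
    rw [fluxMap_apply]
    simp only
    rw [d₂_congr_of_eqOn (ω' := ω) (fun y a b hy => extPlaq_apply _ hy) hc]
    obtain ⟨hx, hij, hjl, -, -, -, -, -, -, hxijl⟩ := mem_cubesIn.1 hc
    obtain ⟨l', hl'⟩ := exists_compl₃_eq i j l hij hjl
    have h1 := hd x l'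
    rw [hl'] at h1
    simp only at h1
    rw [h1, st4.agree x i j l hij hjl ⟨(mem_halfOpenBox_iff_mem_Icc.1 hx).1,
      (mem_halfOpenBox_iff_mem_Icc.1 hxijl).2⟩, hQ₀, extCubeA_apply k hc]
  · -- locality
    intro p hp
    obtain ⟨⟨x, i, j⟩, hpmem⟩ := p
    change ω x i j ≠ 0 at hp
    show A₀ - 2 ≤ x ∧ x ≤ B₀ + 1
    obtain ⟨hlo, hhi⟩ := hsuppω x i j hp
    obtain ⟨-, hpx, -⟩ := mem_plaquettesIn_iff.1 hpmem
    obtain ⟨hp0, hpt⟩ := mem_halfOpenBox_iff_mem_Icc.1 hpx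
    rw [Pi.le_def, Pi.le_def]
    refine ⟨fun a => ?_, fun a => ?_⟩
    · have h1 := hlo a
      have h3 := hp0 a
      simp only [Pi.sub_apply, Pi.ofNat_apply] at h1 h3 ⊢
      rcases st4.local_lo a with h2 | h2
      · have : A₀ a ≤ A₁ a := le_max_left _ _
        omega
      · have := le_zero_of_touchLo k (fun c hc => (hAB c hc).1) h2
        omega
    · have h1 := hhi a
      have h3 := hpt a
      simp only [Pi.add_apply, Pi.one_apply, top] at h1 h3 ⊢
      rcases st4.local_hi a with h2 | h2
      · have : B₁ a ≤ B₀ a := min_le_left _ _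
        omega
      · have := le_of_touchHi k (fun c hc => (hAB c hc).2) h2
        omega
  · -- the sup bound
    intro p
    exact (hle _ _ _).trans hsum

end VillainAngle

end Literature.MathematicalPhysics.QuantumFieldTheory
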